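import Literature.MathematicalPhysics.QuantumFieldTheory.Balaban1983to89.B7Prop6Flat
import Literature.MathematicalPhysics.QuantumFieldTheory.Balaban1983to89.B8Ineq130
import Literature.MathematicalPhysics.QuantumFieldTheory.Balaban1983to89.BlockAveraging

/-!
# `Balaban1983to89.BlockAveragingZd` — T. Bałaban, *Renormalization group approach to lattice gauge field theories. I*, Commun. Math.
# Phys. **109** (1987) 249–301 [Balaban1987RG1], (0.3)–(0.4) pp. 252–253: THE SYMMETRIC BLOCK AVERAGING OF RECORD (centred blocks, ALL
# shortest staircases `G(y,x)` with uniform weights, the guarded `exp[mean log]`) TRANSCRIBED TO THE `ℤᵈ` CARRIERS `Site d → Fin d → 𝔸ˣ`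
# of the [3]∕[6] engine, with the signature shapes of the engine's (42) `bavg` ∕ (43) `avgIter` (`B7Prop1Explicit` ∕ `B7Prop2Explicit`)

statement-level skeleton of published theorems with citation tags; proofs where landed; nothing here is a claim about the Yang–Mills mass gap

[I] = [Balaban1987RG1] (`paper:balaban1987-cmp109-rg-i-small-field`, journal page = PDF page + 248: p0004 L23–L35, p0005 L1–L20), READ by this seat in the
held text; [3] = [Balaban1985Averaging], (8)–(9) p. 18, (42)–(43) pp. 23–24, (11) p. 19, (45) p. 24.
CITATION HEADER (lean-in-tree rule).  Cell `pub-ymgap`, seat `pub-ymgap-dag-n05-e` g35 (the [6]-engine ∕ Prop-6-crown authoring lineage),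
task R0 of the «N05-REC» road (director-ym №251 (4), 2026-08-29: «R0 (banked) AUTHORISED … DEFINITIONS-ONLY … the six predicate record-twins +
`recGF3` + the shift lemma — on dag-n05-e's lane»; plan g90 RULING A3; sizing memos `HOME/pub-ymgap-dag-n05-e/SIZING-HThm4Rec.md`
f0e624eaf2aa2201 + `…-ADDENDUM.md` b1e62ebe2c41e5ac).  Module R0a (of three): the AVERAGE itself.  `--kind definition --supports
stmt-QuantumFields-20541 --as helper` (K0⁷; count-neutral).
WHY.  The tree holds TWO block averagings: (E) the ENGINE's ([3] (42) literally: corner blocks `Ly + [0,L)ᵈ`, ONE staircase `treeWord`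
per block point, weights `L^{−d}`, series `exp`∕`log`, no guard — `B7Prop1Explicit.bavg`, `B7Prop2Explicit.avgIter`) and (R) the
RECORD's ([I] (0.3)–(0.4): NODE 00's `BlockAveraging.blockAvg expMeanLogSU` = `DatumAvLayer.avOfRecord` on the tori — CENTRED blocks,
offsets `off r = r − (L−1)∕2`, ALL staircases `stairWord σ n`, uniform weights over `Idx = {0,…,L−1}ᵈ × S_d × S_d`, loop word
`Γ ∪ [x,x′] ∪ (−Γ′) ∪ (−c)`, the average `exp[mean log]` GUARDED at radius `δ_N = min(1∕3, π∕N)`, value `1` off the guard).  N07's knit of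
record carries ONE conditional premise `HThm4Rec` (`Summits/…/BalabanUVNodesN07Thm4RecordStructure`, p688375) = [6] Prop. 6 for (R); its
discharge road re-runs the [6] engine, typed for (E), over (R).  THIS FILE = first brick: (R) on (E)'s carriers with (E)'s signature
shapes, so the engine's Prop-6 chain can later be re-keyed token by token (`bavg ↦ bavgZ`, `avgIter ↦ avgIterZ`).
WHAT IS DEFINED (bodies) AND PROVED (sorry-free bookkeeping; record twin file:line in brackets).
* §1 `offZ L r` (centred offset; `BlockAveraging.off` :764), `IdxZ d L` (`BlockAveraging.Idx` :758), bounds, the ANCHORING IDENTITY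
  `offZ_eq_boxVec_sub` (centred offset = corner offset `boxVec` − `(L−1)∕2·𝟙`), the level-`k` centre shift `ctrShift L k = (L^k−1)∕2`
  (`two_mul_ctrShift_add_one`, `ctrShift_succ`, odd `L`) — the arithmetic of the road's shift lemma.
* §2 the (0.3)∕(0.4) words ARE NODE 00's `T4Continuum.stairWord` ∕ `loopWord` (REUSED BY NAME; both `Letter` types are `Fin d × Bool`), read
  in the engine's currency: `disp_eq_netDisp`, `disp_stairWord = n`, `disp_loopWord = 0`, `length_stairWord = |n|₁`, `length_loopWord`.
* §3 **`WZ`** (loop variable from the block CENTRE; `loopHol` :777), **`SmallZ L δ`** (the guard; `Small` :785 with `dist1 W = ‖W − 1‖`),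
  **`XZ`** (`Σ_i |Idx|⁻¹ log WZ_i`; `eml`), **`bavgZ`** (`= expUnit XZ · V([q, q+Le_κ])`, (0.4) UNGUARDED — the edition the engine's
  analysis runs on), **`bavgZG L δ`** (`(if SmallZ then expUnit XZ else 1) · V([q,q+Le_κ])`, (0.4) AS OF RECORD = `avgFun` :798 with
  `ESU`), **`avgIterZ`**, **`avgIterZG`** ((43)'s `rescale` recursion; `Averaging.iter`); the guard lemmas `bavgZG_eq_bavgZ_of_small`,
  `bavgZG_eq_of_not_small`, `avgIterZG_eq_avgIterZ_of_small`.
* §4 `V = 1`: `WZ_one`, `XZ_one`, `bavgZ_one`, `bavgZG_one`, `avgIterZ_one`, `avgIterZG_one`.  `WZ_gaugeAct` ([3] (8) on the closed loop);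
  the covariance (11)∕(45) of `XZ ∕ bavgZ ∕ bavgZG ∕ avgIterZ ∕ avgIterZG` is the sibling `BlockAveragingZdCovariance` (proof lane).
DICTIONARY to the torus record (the identification is the road's item R7, NOT claimed here): coarse site `z` ↔ base point `L·z`; `WZ L V
(L·z) κ (r,σ,σ′)` ↔ `loopHol U ⟨z,κ⟩ (r,σ,σ′)`; `SmallZ L δ_N` ↔ `Small expMeanLogSU`; `bavgZG L δ_N` ↔ `avgFun expMeanLogSU`; `avgIterZG`
↔ `Averaging.iter (avOfRecord F N K)`.  DESIGN NOTE: on the small-field domain where `HThm4Rec`'s input class puts every loop variable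
inside `δ_N`, guarded = unguarded level by level (`avgIterZG_eq_avgIterZ_of_small`) — per the (k9) rule of №251 (4) that smallness is a
DISPLAYED letter of the premise, never assumed here.
HONEST SCOPE.  Definitions + kernel bookkeeping; NO inequality of [3]∕[6]∕[I]; `HThm4Rec` UNDISCHARGED (this file discharges nothing);
N05-REC R1–R7 NOT commissioned; N05 ∕ N07 NOT discharged; counts unmoved (typed 28∕28 · discharged 7∕28); one finite 𝕋⁴ programme at
fixed ε — nothing continuum ∕ ℝ⁴ ∕ OS ∕ mass gap ∕ Clay.  No `instance`, no `notation`, no `sorry`.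
-/

set_option autoImplicit false

noncomputable section

open scoped BigOperators

namespace Literature.MathematicalPhysics.QuantumFieldTheory.Balaban1983to89.BlockAveragingZd

open B7Prop1Explicit (Letter e e_apply disp disp_cons disp_nil disp_append disp_seg hol hol_gaugeAct hol_gaugeAct_closed
  gaugeAct seg l1 boxVec expUnit val_expUnit U1 revWord)
open B7Prop2Explicit (rescale rescale_apply)
-- `Site` alone resolves to the torus sites `…Balaban1983to89.Site P j` in this namespace; the engine's `ℤᵈ` sites get an alias.
open B7Prop1Explicit renaming Site → SiteZ
open B8Ineq130 (hol_one)
open MatrixLog (mlog mlog_one)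
open T4Continuum (netDisp axisRun stairRuns stairWord loopWord wordRev netDisp_stairWord netDisp_loopWord)

variable {d : ℕ}

/-! ## §1 Centred blocks: offsets, the index set of the double average, the anchoring identity -/

/-- **The centred offset `n = r − (L−1)∕2` of a block point** ([I] p. 252: «x − y = Σ_μ δ n_μ e_μ, |n_μ| ≦ (L−1)∕2»), on the `ℤᵈ`
carriers; verbatim NODE 00's `BlockAveraging.off` with `P.L ↦ L`. [cite: Balaban1987RG1, (0.3) p.252] -/
def offZ (L : ℕ) (r : Fin d → Fin L) : SiteZ d := fun ν => ((r ν : ℕ) : ℤ) - (((L - 1) / 2 : ℕ) : ℤ)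

/-- `offZ` coordinatewise. [cite: Balaban1987RG1, (0.3) p.252] -/
theorem offZ_apply (L : ℕ) (r : Fin d → Fin L) (ν : Fin d) :
    offZ L r ν = ((r ν : ℕ) : ℤ) - (((L - 1) / 2 : ℕ) : ℤ) := rfl

/-- `−(L−1)∕2 ≤ n_ν ≤ L − 1 − (L−1)∕2` (for odd `L` the symmetric range `|n_ν| ≤ (L−1)∕2`). [cite: Balaban1987RG1, (0.3) p.252] -/
theorem offZ_bounds (L : ℕ) (r : Fin d → Fin L) (ν : Fin d) :
    -(((L - 1) / 2 : ℕ) : ℤ) ≤ offZ L r ν ∧ offZ L r ν ≤ ((L : ℤ) - 1) - (((L - 1) / 2 : ℕ) : ℤ) := by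
  have hr := (r ν).isLt
  simp only [offZ_apply]
  constructor <;> omega

/-- For odd `L = 2s + 1`: `|n_ν| ≤ s`. [cite: Balaban1987RG1, (0.3) p.252] -/
theorem natAbs_offZ_le {L s : ℕ} (hL : L = 2 * s + 1) (r : Fin d → Fin L) (ν : Fin d) : (offZ L r ν).natAbs ≤ s := by
  have hr := (r ν).isLt
  have hs : (L - 1) / 2 = s := by omega
  simp only [offZ_apply, hs]
  omega

/-- For odd `L = 2s + 1` the staircase to a block point has at most `d·s` bonds: `|n|₁ ≤ d·(L−1)∕2`. [cite: Balaban1987RG1, (0.3) p.252] -/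
theorem l1_offZ_le {L s : ℕ} (hL : L = 2 * s + 1) (r : Fin d → Fin L) : l1 (offZ L r) ≤ d * s := by
  unfold l1
  calc ∑ ν, (offZ L r ν).natAbs ≤ ∑ _ν : Fin d, s := Finset.sum_le_sum fun ν _ => natAbs_offZ_le hL r ν
    _ = d * s := by simp

/-- **THE ANCHORING IDENTITY (one step)**: the centred offset is the engine's corner offset `boxVec` translated by the constant vector
`−(L−1)∕2·𝟙` — the centred block of `y` is the corner block of `y` shifted as a whole. [cite: Balaban1987RG1, (0.3) p.252; Balaban1985Averaging, (2) p.17] -/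
theorem offZ_eq_boxVec_sub (L : ℕ) (r : Fin d → Fin L) :
    offZ L r = boxVec L r - fun _ => (((L - 1) / 2 : ℕ) : ℤ) := by
  funext ν
  rfl

/-- **The index set of the double average (0.4)** at a coarse bond: the block point through `r ∈ {0,…,L−1}ᵈ` and the two orderings
`σ, σ′` of the axes generating `Γ ∈ G(c₋,x)`, `Γ′ ∈ G(c₊,x′)`; verbatim NODE 00's `BlockAveraging.Idx`.  Uniform weights on it ARE
the printed weights `L^{−d}|G(c₋,x)|⁻¹|G(c₊,x′)|⁻¹` (each contour arises from `d!∕|G|` orderings). [cite: Balaban1987RG1, (0.4) p.253] -/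
abbrev IdxZ (d L : ℕ) : Type := (Fin d → Fin L) × Equiv.Perm (Fin d) × Equiv.Perm (Fin d)

/-- **The centre shift at level `k`**: `(L^k − 1)∕2`, the distance (in finest-lattice units, per coordinate) between the lowest
corner of a level-`k` block and its centre; the road's shift lemma translates every anchoring-only engine object by this vector.
[cite: Balaban1987RG1, (0.3) p.252; Balaban1985Averaging, (1)–(2) p.17] -/
def ctrShift (L k : ℕ) : ℕ := (L ^ k - 1) / 2

/-- For odd `L`: `2·ctrShift L k + 1 = L^k` (the level-`k` block has odd side `L^k`, its centre is a lattice point).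
[cite: Balaban1987RG1, (0.3) p.252] -/
theorem two_mul_ctrShift_add_one {L : ℕ} (hL : Odd L) (k : ℕ) : 2 * ctrShift L k + 1 = L ^ k := by
  obtain ⟨t, ht⟩ := (hL.pow (n := k))
  unfold ctrShift
  omega

/-- Nesting of centres (odd `L`): `ctrShift L (k+1) = L · ctrShift L k + (L−1)∕2` — the centre of the level-`(k+1)` block is the
centre of its central level-`k` sub-block. [cite: Balaban1987RG1, (0.3) p.252] -/
theorem ctrShift_succ {L : ℕ} (hL : Odd L) (k : ℕ) : ctrShift L (k + 1) = L * ctrShift L k + (L - 1) / 2 := by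
  have h1 := two_mul_ctrShift_add_one hL k
  have h2 := two_mul_ctrShift_add_one hL (k + 1)
  obtain ⟨s, hs⟩ := hL
  rw [pow_succ] at h2
  have h3 : (L - 1) / 2 = s := by omega
  rw [h3]
  have h4 : 2 * ctrShift L (k + 1) + 1 = (2 * ctrShift L k + 1) * (2 * s + 1) := by rw [h2, h1, hs]
  nlinarith [h4]

/-! ## §2 The printed contours (0.3) and loop words (0.4) — NODE 00's words, read in the engine's currency -/

/-- The engine's vector displacement `disp` and NODE 00's coordinatewise `netDisp` agree (two bookkeepings of [3] (9)'s contours). [cite: Balaban1985Averaging, (9) p.18] -/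
theorem disp_eq_netDisp : ∀ (w : List (Letter d)) (ν : Fin d), disp w ν = netDisp w ν
  | [], ν => by simp [T4Continuum.netDisp]
  | l :: w, ν => by
    obtain ⟨μ, b⟩ := l
    have hcons : netDisp ((μ, b) :: w) ν = (if μ = ν then (if b then (1 : ℤ) else -1) else 0) + netDisp w ν := by
      simp [T4Continuum.netDisp]
    rw [disp_cons, Pi.add_apply, disp_eq_netDisp w ν, hcons]
    congr 1
    cases b <;> by_cases h : μ = ν
    · subst h; simp [B7Prop1Explicit.Letter.vec, e_apply]
    · simp [B7Prop1Explicit.Letter.vec, e_apply, h, Ne.symm h]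
    · subst h; simp [B7Prop1Explicit.Letter.vec, e_apply]
    · simp [B7Prop1Explicit.Letter.vec, e_apply, h, Ne.symm h]

/-- **The staircase `Γ ∈ G(y, x)` ends at `x`**: `disp (stairWord σ n) = n`. [cite: Balaban1987RG1, (0.3) p.252] -/
theorem disp_stairWord (σ : Equiv.Perm (Fin d)) (n : Fin d → ℤ) : disp (stairWord σ n) = n := by
  funext ν
  rw [disp_eq_netDisp, netDisp_stairWord]

/-- **The loop `Γ ∪ [x,x′] ∪ (−Γ′) ∪ (−c)` is closed**: `disp (loopWord L κ n σ σ′) = 0`. [cite: Balaban1987RG1, (0.4) p.253] -/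
theorem disp_loopWord (L : ℕ) (κ : Fin d) (n : Fin d → ℤ) (σ σ' : Equiv.Perm (Fin d)) :
    disp (loopWord L κ n σ σ') = 0 := by
  funext ν
  rw [disp_eq_netDisp, netDisp_loopWord]
  rfl

/-- Length of a run of (0.3)'s staircase. [cite: Balaban1987RG1, (0.3) p.252] -/
theorem length_axisRun (μ : Fin d) (k : ℤ) : (axisRun μ k).length = k.natAbs := by
  simp [T4Continuum.axisRun]

/-- Length of (0.3)'s staircase through a list of axes. [cite: Balaban1987RG1, (0.3) p.252] -/
theorem length_stairRuns (n : Fin d → ℤ) : ∀ as : List (Fin d), (stairRuns n as).length = (as.map fun a => (n a).natAbs).sum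
  | [] => by simp [T4Continuum.stairRuns]
  | a :: as => by
    simp [T4Continuum.stairRuns, length_axisRun, length_stairRuns n as]

/-- **`|Γ| = |n|₁` for every `Γ ∈ G(y, x)`** («shortest contours», [I] p. 252). [cite: Balaban1987RG1, (0.3) p.252] -/
theorem length_stairWord (σ : Equiv.Perm (Fin d)) (n : Fin d → ℤ) : (stairWord σ n).length = l1 n := by
  rw [T4Continuum.stairWord, length_stairRuns, List.map_map]
  unfold l1
  rw [← Equiv.sum_comp σ (fun a => (n a).natAbs), Fin.sum_univ_def]
  rfl

/-- Length of a reversed word (NODE 00's `wordRev`; `V(−Γ) = V(Γ)⁻¹` of [3] (9)); private: the same list fact is stated in a Summits file. [cite: Balaban1985Averaging, (9) p.18] -/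
private theorem length_wordRev (w : List (Letter d)) : (wordRev w).length = w.length := by
  simp [T4Continuum.wordRev]

/-- **`|Γ ∪ [x,x′] ∪ (−Γ′) ∪ (−c)| = 2|n|₁ + 2L`**. [cite: Balaban1987RG1, (0.4) p.253] -/
theorem length_loopWord (L : ℕ) (κ : Fin d) (n : Fin d → ℤ) (σ σ' : Equiv.Perm (Fin d)) :
    (loopWord L κ n σ σ').length = 2 * l1 n + 2 * L := by
  simp only [T4Continuum.loopWord, List.length_append, length_stairWord, List.length_replicate, length_wordRev]
  ring

/-! ## §3 The loop variables, the exponent, the one-step and `k`-fold averages (0.4) on `ℤᵈ` -/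

section LoopVariables

variable {G : Type*} [Group G] (L : ℕ)

/-- **The loop variable `V(Γ ∪ [x,x′] ∪ (−Γ′) ∪ (−c))` of (0.4)** for the coarse bond `c = ⟨q, q + Le_κ⟩` based at the block CENTRE
`q`, the block point `x = q + n` (`n = offZ L r`) and the orderings `σ, σ′`: the engine's parallel transport (9) `hol` along NODE 00's
loop word (`BlockAveraging.loopHol` read on `ℤᵈ`). [cite: Balaban1987RG1, (0.4) p.253; Balaban1985Averaging, (9) p.18] -/
def WZ (V : SiteZ d → Fin d → G) (q : SiteZ d) (κ : Fin d) (i : IdxZ d L) : G :=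
  hol V q (loopWord L κ (offZ L i.1) i.2.1 i.2.2)

/-- Unfolding `WZ`. [cite: Balaban1987RG1, (0.4) p.253] -/
theorem WZ_def (V : SiteZ d → Fin d → G) (q : SiteZ d) (κ : Fin d) (i : IdxZ d L) :
    WZ L V q κ i = hol V q (loopWord L κ (offZ L i.1) i.2.1 i.2.2) := rfl

/-- **[3] (8) on a closed loop**: `WZ[V^u] = u(q) · WZ[V] · u(q)⁻¹` for EVERY gauge function `u`. [cite: Balaban1985Averaging, (8) p.18; Balaban1987RG1, (0.4) p.253] -/
theorem WZ_gaugeAct (u : SiteZ d → G) (V : SiteZ d → Fin d → G) (q : SiteZ d) (κ : Fin d) (i : IdxZ d L) :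
    WZ L (gaugeAct u V) q κ i = u q * WZ L V q κ i * (u q)⁻¹ := by
  unfold WZ
  rw [hol_gaugeAct_closed u V q _ (disp_loopWord L κ _ _ _)]

/-- The loop variables (0.4) of the configuration `1` are `1`. [cite: Balaban1987RG1, (0.4) p.253] -/
theorem WZ_one (q : SiteZ d) (κ : Fin d) (i : IdxZ d L) : WZ L (1 : SiteZ d → Fin d → G) q κ i = 1 := by
  simp [WZ, hol_one]

end LoopVariables

section Guard

variable {𝔸 : Type*} [NormedRing 𝔸] (L : ℕ)

/-- **The small-field guard of (0.4)** at the coarse bond `⟨q, q + Le_κ⟩`: every loop variable within `δ` of `1` («for a set {U_j} of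
elements close to the identity of the group», [I] p. 253; NODE 00's `BlockAveraging.Small` with `dist1 W = ‖W − 1‖`, radius
`δ_N = min(1∕3, π∕N)` of `expMeanLogSU`). [cite: Balaban1987RG1, (0.4) p.253] -/
def SmallZ (δ : ℝ) (V : SiteZ d → Fin d → 𝔸ˣ) (q : SiteZ d) (κ : Fin d) : Prop :=
  ∀ i : IdxZ d L, ‖((WZ L V q κ i : 𝔸ˣ) : 𝔸) - 1‖ < δ

/-- The configuration `1` is inside every guard (0.4) of positive radius. [cite: Balaban1987RG1, (0.4) p.253] -/
theorem smallZ_one {δ : ℝ} (hδ : 0 < δ) (q : SiteZ d) (κ : Fin d) : SmallZ L δ (1 : SiteZ d → Fin d → 𝔸ˣ) q κ := by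
  intro i
  simpa [WZ_one] using hδ

end Guard

section Average

variable {𝔸 : Type*} [NormedRing 𝔸] [NormedAlgebra ℂ 𝔸] (L : ℕ)

/-- **The exponent of (0.4)**: `XZ = Σ_{x∈B(c₋)} L^{−d} Σ_Γ |G|⁻¹ Σ_Γ′ |G|⁻¹ log V(Γ ∪ [x,x′] ∪ (−Γ′) ∪ (−c))` realised as the UNIFORM
mean over `IdxZ d L` of the series logarithms of the loop variables (NODE 00's `eml`, `log = MatrixLog.mlog`; the engine's (42) `Xavg`
has ONE contour per point and weights `L^{−d}`). [cite: Balaban1987RG1, (0.4) p.253; Balaban1985Averaging, (42) p.23] -/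
def XZ (V : SiteZ d → Fin d → 𝔸ˣ) (q : SiteZ d) (κ : Fin d) : 𝔸 :=
  ∑ i : IdxZ d L, ((Fintype.card (IdxZ d L) : ℝ))⁻¹ • mlog ((WZ L V q κ i : 𝔸ˣ) : 𝔸)

/-- The exponent of (0.4) of the configuration `1` vanishes (`log 1 = 0`). [cite: Balaban1987RG1, (0.4) p.253] -/
theorem XZ_one (q : SiteZ d) (κ : Fin d) : XZ L (1 : SiteZ d → Fin d → 𝔸ˣ) q κ = 0 := by
  simp [XZ, WZ_one, mlog_one]

variable [CompleteSpace 𝔸]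

/-- **(0.4) UNGUARDED on `ℤᵈ`** — `Ū(c) = exp[XZ] · U(c)` for `c = ⟨q, q + Le_κ⟩` based at the block CENTRE `q`, `U(c)` the straight
transporter `V([q, q + Le_κ])`: the engine's (42) `bavg` with the record's contour system and weights.  This is the edition the
engine's analysis runs on (analytic in `V`); the record's guarded edition is `bavgZG`. [cite: Balaban1987RG1, (0.4) p.253; Balaban1985Averaging, (42) p.23] -/
def bavgZ (V : SiteZ d → Fin d → 𝔸ˣ) : SiteZ d → Fin d → 𝔸ˣ := fun q κ => expUnit (XZ L V q κ) * hol V q (seg κ L)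

/-- Unfolding `bavgZ`. [cite: Balaban1987RG1, (0.4) p.253] -/
theorem bavgZ_apply (V : SiteZ d → Fin d → 𝔸ˣ) (q : SiteZ d) (κ : Fin d) :
    bavgZ L V q κ = expUnit (XZ L V q κ) * hol V q (seg κ L) := rfl

open scoped Classical in
/-- **(0.4) AS OF RECORD on `ℤᵈ` (GUARDED)** — `M(U, c) · U(c)` with the correction factor `exp[XZ]` on the small-field guard and `1`
off it (NODE 00's `avgFun = corr · axialAvg` with `corr = if Small then E else 1`, `E = ESU` itself guarded at the same radius):
the TOTAL map whose torus edition is `avOfRecord`. [cite: Balaban1987RG1, (0.4) p.253] -/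
def bavgZG (δ : ℝ) (V : SiteZ d → Fin d → 𝔸ˣ) : SiteZ d → Fin d → 𝔸ˣ := fun q κ =>
  (if SmallZ L δ V q κ then expUnit (XZ L V q κ) else 1) * hol V q (seg κ L)

/-- ON THE GUARD the record's average IS the unguarded (0.4). [cite: Balaban1987RG1, (0.4) p.253] -/
theorem bavgZG_eq_bavgZ_of_small {δ : ℝ} {V : SiteZ d → Fin d → 𝔸ˣ} {q : SiteZ d} {κ : Fin d} (h : SmallZ L δ V q κ) :
    bavgZG L δ V q κ = bavgZ L V q κ := by
  classical
  simp [bavgZG, bavgZ, h]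

/-- OFF THE GUARD the record's average is the axial (straight-line) average `V([q, q + Le_κ])`. [cite: Balaban1987RG1, (0.4) p.253] -/
theorem bavgZG_eq_of_not_small {δ : ℝ} {V : SiteZ d → Fin d → 𝔸ˣ} {q : SiteZ d} {κ : Fin d} (h : ¬ SmallZ L δ V q κ) :
    bavgZG L δ V q κ = hol V q (seg κ L) := by
  classical
  simp [bavgZG, h]

/-- **The `k`-fold average, UNGUARDED** — (43)'s recursion `Ū^{j+1} = rescale L (\overline{Ū^{j}})` with every level identified with `ℤᵈ`
(the engine's `avgIter` with `bavg ↦ bavgZ`; level-`k` blocks are then CENTRED at `L^k z`: `L^k z + [−(L^k−1)∕2, (L^k−1)∕2]ᵈ`).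
[cite: Balaban1987RG1, (0.4) p.253; Balaban1985Averaging, (43) p.24] -/
def avgIterZ (V : SiteZ d → Fin d → 𝔸ˣ) : ℕ → SiteZ d → Fin d → 𝔸ˣ
  | 0 => V
  | j + 1 => rescale L (bavgZ L (avgIterZ V j))

/-- `Ū^0 = U`. [cite: Balaban1985Averaging, (43) p.24] -/
@[simp] theorem avgIterZ_zero (V : SiteZ d → Fin d → 𝔸ˣ) : avgIterZ L V 0 = V := rfl

/-- `Ū^{j+1} = rescale L (\overline{Ū^{j}})`. [cite: Balaban1985Averaging, (43) p.24] -/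
theorem avgIterZ_succ (V : SiteZ d → Fin d → 𝔸ˣ) (j : ℕ) : avgIterZ L V (j + 1) = rescale L (bavgZ L (avgIterZ L V j)) := rfl

/-- **The `k`-fold average AS OF RECORD (GUARDED)** — NODE 00's `Averaging.iter (avOfRecord …)` read on `ℤᵈ`. [cite: Balaban1987RG1, (0.4) p.253; Balaban1985Averaging, (43) p.24] -/
def avgIterZG (δ : ℝ) (V : SiteZ d → Fin d → 𝔸ˣ) : ℕ → SiteZ d → Fin d → 𝔸ˣ
  | 0 => V
  | j + 1 => rescale L (bavgZG L δ (avgIterZG δ V j))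

/-- `Ū^0 = U` (guarded edition). [cite: Balaban1985Averaging, (43) p.24] -/
@[simp] theorem avgIterZG_zero (δ : ℝ) (V : SiteZ d → Fin d → 𝔸ˣ) : avgIterZG L δ V 0 = V := rfl

/-- `Ū^{j+1} = rescale L (\overline{Ū^{j}})` (guarded edition). [cite: Balaban1985Averaging, (43) p.24] -/
theorem avgIterZG_succ (δ : ℝ) (V : SiteZ d → Fin d → 𝔸ˣ) (j : ℕ) :
    avgIterZG L δ V (j + 1) = rescale L (bavgZG L δ (avgIterZG L δ V j)) := rfl

/-- The two `k`-fold editions agree up to level `k` whenever every intermediate average stays inside the guard. [cite: Balaban1987RG1, (0.4) p.253] -/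
theorem avgIterZG_eq_avgIterZ_of_small {δ : ℝ} {V : SiteZ d → Fin d → 𝔸ˣ} {k : ℕ}
    (h : ∀ j < k, ∀ q κ, SmallZ L δ (avgIterZ L V j) q κ) : ∀ j ≤ k, avgIterZG L δ V j = avgIterZ L V j
  | 0, _ => rfl
  | j + 1, hj => by
    have ih := avgIterZG_eq_avgIterZ_of_small h j (Nat.le_of_succ_le hj)
    rw [avgIterZG_succ, avgIterZ_succ, ih]
    congr 1
    funext q κ
    exact bavgZG_eq_bavgZ_of_small L (h j (Nat.lt_of_succ_le hj) q κ)

/-! ## §4 The configuration `1` -/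

/-- **The (0.4) average of `1` is `1`** (unguarded). [cite: Balaban1987RG1, (0.4) p.253] -/
theorem bavgZ_one (q : SiteZ d) (κ : Fin d) : bavgZ L (1 : SiteZ d → Fin d → 𝔸ˣ) q κ = 1 := by
  apply Units.ext
  simp [bavgZ, XZ_one, hol_one]

/-- **The (0.4) average of `1` is `1`** (guarded, any radius). [cite: Balaban1987RG1, (0.4) p.253] -/
theorem bavgZG_one (δ : ℝ) (q : SiteZ d) (κ : Fin d) : bavgZG L δ (1 : SiteZ d → Fin d → 𝔸ˣ) q κ = 1 := by
  classical
  apply Units.ext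
  by_cases h : SmallZ L δ (1 : SiteZ d → Fin d → 𝔸ˣ) q κ <;> simp [bavgZG, h, XZ_one, hol_one]

omit [NormedAlgebra ℂ 𝔸] [CompleteSpace 𝔸] in
/-- `rescale L 1 = 1` (the identification `Lℤᵈ ≅ ℤᵈ` of [3] (1) fixes the unit configuration). [cite: Balaban1985Averaging, (1) p.17] -/
theorem rescale_one : rescale L (1 : SiteZ d → Fin d → 𝔸ˣ) = 1 := by
  funext z κ
  simp [rescale_apply]

/-- The `k`-fold (0.4) average of `1` is `1` (unguarded). [cite: Balaban1987RG1, (0.4) p.253; Balaban1985Averaging, (43) p.24] -/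
theorem avgIterZ_one : ∀ j : ℕ, avgIterZ L (1 : SiteZ d → Fin d → 𝔸ˣ) j = 1
  | 0 => rfl
  | j + 1 => by
    rw [avgIterZ_succ, avgIterZ_one j]
    have h : bavgZ L (1 : SiteZ d → Fin d → 𝔸ˣ) = 1 := by
      funext q κ
      exact bavgZ_one L q κ
    rw [h, rescale_one]

/-- The `k`-fold (0.4) average of `1` is `1` (guarded). [cite: Balaban1987RG1, (0.4) p.253; Balaban1985Averaging, (43) p.24] -/
theorem avgIterZG_one (δ : ℝ) : ∀ j : ℕ, avgIterZG L δ (1 : SiteZ d → Fin d → 𝔸ˣ) j = 1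
  | 0 => rfl
  | j + 1 => by
    rw [avgIterZG_succ, avgIterZG_one δ j]
    have h : bavgZG L δ (1 : SiteZ d → Fin d → 𝔸ˣ) = 1 := by
      funext q κ
      exact bavgZG_one L δ q κ
    rw [h, rescale_one]

end Average

end Literature.MathematicalPhysics.QuantumFieldTheory.Balaban1983to89.BlockAveragingZd
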